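import Literature.MathematicalPhysics.QuantumFieldTheory.Balaban1983to89.T4TiltModulus

/-!
# `Balaban1983to89.T4CovarianceResponse` — the COVARIANCE RESPONSE of the conditional mean in the exterior field:
# `d/dθ E_θ[F] = −Cov_θ(g, F)` along the exponential interpolation of two fibre Gibbs densities, hence
# `‖E_u[F] − E_{u₀}[F]‖ ≤ sup_θ √Var_θ(g)·√Var_θ(F)` — a THIRD by-name supplier of pv16's `MeanLipschitz` /
# `CondMeanSuppression` (cell T4, node O3b/H2 = NE1′, row O3.E-i′ (β); bookkeeping, Mathlib only)

HONEST FRAMING.  Audit cell `pub-balaban`, unit `b2b-balaban-pv16-g11` (SURGE NODE PROVER #16, journal row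
`T4-O3.E-i′-β-CONVRESP*`, self-proposed under the yield clause of T4-DAG v15 row O3.E-i′ (β); companion record
`HOME/t4/T4-EST-O3Ei1.md`).  The cell's T4 target is the existence and uniqueness of the continuum limit of unit-scale
averaged loop expectations on a FINITE torus, with Bałaban's densities as GIVEN data satisfying the printed end statement (B)
as a HYPOTHESIS; it is NOT an infinite-volume statement, NOT a mass gap, NOT the Clay problem, and this module is NOT
progress on any summit.  Value = one kernel-checked piece of measure-theoretic bookkeeping and nothing more.  CONTEXT: the
pv16 lineage typed the first-order size mechanism `T4FirstOrderSize.MeanLipschitz` / `CondMeanSuppression` (the conditional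
mean field of bond inserts is Lipschitz in the exterior field, relative to a flat reference where it vanishes) and two
suppliers from the TILT MODULUS (`T4TiltModulus.meanLipschitz_of_tilt`, `T4TiltModulusRelative.meanLipschitz_of_relTilt`):
`‖E_u F − E_{u₀} F‖ ≤ (e^{2ε} − 1)·M` for fibre densities ratio-close with oscillation `ε`.  The pv28 lineage (row
`T4-O3.E-iii-b-G7-LOGSIZE*`, record `t4/T4-EST-O3Eiiib-G7.md` §2quater (E-LOGSIZE)/(L-e)) then showed that on the printed
windows the oscillation `ε` of the exponent gap is NOT small uniformly in the step, so the factor `e^{2ε₀}` of the tilt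
suppliers is unusable there, while «the consumer shape is right».  THIS MODULE supplies the same consumer shapes from a
DIFFERENT abstract input — second moments along the interpolation path instead of a sup-norm ratio bound — in which the
exponential factor never appears: the constant is LINEAR in the oscillation unconditionally (§1 (R5)), and is the product of
two standard deviations when variance bounds along the path are available (§1 (R4); they are INPUTS, caveat (VAR)).

CITATION HEADER.  What is taken from T. Bałaban's series (CMP 1984–89) is ONLY what the imported tree modules already quote
and model, re-used BY NAME: the conditional fibre law `T4DressingDefect.condLaw` of an integrated density (one term of the
large-field operation [Balaban1989LargeFieldI] (0.3) p. 176 / (1.100)–(1.102) p. 201 as modelled by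
`B15.BasicStep.fibreIntegral`, with the printed proviso «the denominators are positive» as the binder `fibreIntegral ≠ 0`),
its identification with a normalised law `T4TiltModulus.condLaw_eq_normLaw`, the Gibbs shape `χ·e^{h}` with an
exterior-blind window exactly as in `T4TiltModulus.fibreRatioClose_of_exp`, and the hypothesis shapes
`T4FirstOrderSize.MeanLipschitz` / `MeanVanishes` / `CondMeanSuppression`.  No page of the series was newly read for this
module; no sentence is newly attributed to it; nothing of Bałaban's averaging, small-field densities, minimisers or R beyond
the cited tree shapes is encoded (cell DIVERGENCE F6/F9 honoured).  The mathematics of §1 is the textbook «fluctuation–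
response» identity of exponential families (derivative of a Gibbs mean in the coupling = minus a covariance) with the
Cauchy–Schwarz inequality and the mean value inequality; it is [folklore] and carries no `[cite:]`.  ABSOLUTE RULE honoured:
no programme-internal statement is a hypothesis-free input — every size enters as a binder; every declaration [folklore].

WHAT IS PROVED (all [folklore]; no `sorry`, no new axiom):
§1 ABSTRACT (a measurable space `S`, a finite measure `ν`, Mathlib only).  For a reference density `q₀` (measurable,
   `0 ≤ q₀ ≤ C`, `∫q₀ dν > 0`) and a bounded measurable exponent `g` (`|g| ≤ K`) — the standing data `TiltData ν q₀ g` —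
   the EXPONENTIAL INTERPOLATION `expTilt q₀ g θ = q₀·e^{−θg}` (`θ ∈ ℝ`), its mass `tiltZ`, the TILTED LAW
   `tiltLaw ν q₀ g θ = normLaw ν (q₀e^{−θg})` (a probability measure, `isProbabilityMeasure_tiltLaw`), the tilted mean
   `tiltMean … F θ = ∫F d(tiltLaw θ)` of a bounded a.e.-strongly-measurable Banach-valued insert `F`, the path covariance
   `tiltCov … F θ = E_θ[(g − E_θ g)•(F − E_θ F)]` and the path variance `tiltVar … F θ = E_θ‖F − E_θ F‖²`.
   (R1) `tiltMean_eq_smul`: `E_θ F = Z(θ)⁻¹ • ∫ q_θ•F dν`;  (R2) differentiation under the integral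
   (`hasDerivAt_tiltZ`, `hasDerivAt_tiltN`, Mathlib's `hasDerivAt_integral_of_dominated_loc_of_deriv_le` with a constant
   dominating function on a unit ball of parameters) and THE RESPONSE IDENTITY `hasDerivAt_tiltMean`:
   `d/dθ E_θ F = −Cov_θ(g, F)` (with `tiltCov_eq_sub`: centred = uncentred covariance);  (R3) Cauchy–Schwarz
   `norm_tiltCov_le`: `‖Cov_θ(g,F)‖ ≤ √Var_θ g · √Var_θ F` (Mathlib's `integral_mul_le_Lp_mul_Lq_of_nonneg`, `p = q = 2`);
   (R4) the mean value inequality on `[0,1]` (`norm_image_sub_le_of_norm_deriv_le_segment_01'`):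
   `norm_tiltMean_one_sub_zero_le`: variance bounds `Var_θ g ≤ Vg`, `Var_θ F ≤ VF` for `θ ∈ [0,1]` give
   `‖E₁F − E₀F‖ ≤ √Vg·√VF`;  (R5) the UNCONDITIONAL oscillation form `norm_tiltMean_one_sub_zero_le_of_osc`: `|g − κ| ≤ ε`
   and `‖F − c‖ ≤ M` pointwise (free constants `κ`, `c`) give `Var_θ g ≤ ε²`, `Var_θ F ≤ (2M)²`
   (`tiltVar_le_of_abs_sub_le`, `tiltVar_le_of_norm_sub_le`) hence `‖E₁F − E₀F‖ ≤ ε·(2M)` — to be compared with the tilt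
   modulus `(e^{2ε} − 1)·M ≥ 2εM` of `T4TiltModulus.norm_integral_normLaw_sub_le` for the same data
   (`osc_bound_le_tilt_bound`, kernel-checked dominance): the exponential is gone for every `ε`.
§2 FIBRE (the cell's data).  For a Gibbs density `old = χ·e^{h}` (`χ, h` measurable, `0 ≤ χ`, `old ≤ C`) with the printed
   proviso at the reference exterior `u₀` and a window EXTERIOR-BLIND on the fibre through `s` between `u` and `u₀`
   (`χ(u←y) = χ(u₀←y)`), the fibre density at `u` IS the `θ = 1` interpolant of the fibre density at `u₀` with exponent the
   EXPONENT GAP `expGap s h u₀ u : y ↦ h(u₀←y) − h(u←y)` (`fibreDensity_eq_expTilt_one`), so `condLaw s old u` /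
   `condLaw s old u₀` are the endpoints of the PATH LAW `pathLaw s χ h u₀ u θ` (`condLaw_eq_pathLaw_one/zero`; the path law
   is the normalised law of `χ(u₀←·)·e^{(1−θ)h(u₀←·) + θh(u←·)}`, `pathLaw_eq_normLaw_interp`; constant `= condLaw s old u₀`
   at `u = u₀`, `pathLaw_self` / `pathVar_self`), and §1 gives
   `norm_condMean_sub_le_of_varianceBound` (‖E_u F − E_{u₀} F‖ ≤ √Vg·√VF from path-variance bounds `pathVar`) and
   `norm_condMean_sub_le_of_osc` (≤ ε·(2M) from `|expGap − κ| ≤ ε`, `‖F − c‖ ≤ M`).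
§3 DISCHARGE BY NAME of pv16's shapes, in exactly the format of `T4TiltModulus` §3: on the RESPONSE DOMAIN
   `respDom s χ h u₀ B S dev σ τ` (blind window, bounded gap, `0 ≤ dev u`, path variances of the gap `≤ (σ·dev u)²` and of
   each insert `≤ τ²`) `meanLipschitz_of_varianceBound` gives `MeanLipschitz … u₀ dev (σ·τ)` and, with `MeanVanishes` at
   `u₀`, `condMeanSuppression_of_varianceBound`; on the OSCILLATION DOMAIN `oscDom s χ h u₀ ε` (blind window,
   `|expGap − κ u| ≤ ε u` for a free constant field `κ`, `0 ≤ ε u` — `T4TiltModulus.tiltDom` for Gibbs data WITHOUT the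
   ceiling `ε ≤ ε₀`) `meanLipschitz_of_osc` gives `MeanLipschitz … u₀ ε (2M)` (vs. `2e^{2ε₀}M` of `meanLipschitz_of_tilt`)
   and `condMeanSuppression_of_osc`; the pair-mean versions `pairMeanField_lipschitz_of_osc` / `pairMeanField_norm_le_of_osc`
   (binder `hL` of `T4CoReadMoment.pairMean_norm_le_of_lipschitz`, as `T4TiltModulus.pairMeanField_lipschitz_of_tilt`);
   non-vacuity `self_mem_respDom` / `self_mem_oscDom`.  Either `CondMeanSuppression` output feeds
   `T4CondMeanChannel.condMean_channel_of_suppression` verbatim.  CENSUS: 71 declarations (1 structure, 12 definitions,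
   58 theorems).

HONEST SCOPE / NOT PROVED — CAVEATS.  (VAR) The path-variance bounds `Var_θ(expGap) ≤ (σ·dev u)²`, `Var_θ(B b) ≤ τ²`
(for the instantiating seat: a spectral-gap / Brascamp–Lieb input for the interpolated fibre Gibbs laws, `σ ≈ b_H/√m_H`,
`τ ≈ Lip(B)/√m_H` in the notation of record `t4/T4-EST-O3Eiiib-G7.md`) are INPUTS typed as set-membership conditions;
NOTHING of the kind is proved here for Bałaban's densities, and this module does not claim they hold on the printed
windows.  (K) The sup bound `K` of the exponent gap enters ONLY qualitatively (differentiability under the integral); no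
constant depends on it.  (BLIND) The window must be exterior-blind on the fibre, exactly hypothesis `hχ` of
`T4TiltModulus.fibreRatioClose_of_exp` (the (S-TILT) caveat in Gibbs form); inserts are exterior-independent (caveat (B-INS)
of `T4TiltModulus`; the exterior-dependent correction is additive as there).  (LOG) The identification of `dev`, `ε`, `κ`
with distances of `u` from `u₀` for Bałaban's exponents is the pv28 lineage's, not this module's.  (FLAT) `MeanVanishes` at
`u₀` (row O3.E-i′ (α)/K) is a binder.  (OSC) The oscillation form (R5) removes the exponential of the tilt modulus but is
still only as small as `ε`; where `ε ≳ 1` (the (E-LOGSIZE) regime) only the variance form (R4) with a genuine (VAR) input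
can be small — that input is OPEN.  DEPENDENCIES: `T4TiltModulus` (hence `T4FirstOrderSize`, `T4DressingDefect`,
`T4CoReadMoment`) and Mathlib; no new axiom; every declaration [folklore], no `[cite:]`.
-/

noncomputable section

open _root_.MeasureTheory
open Function (updateFinset)
open scoped ENNReal

namespace Literature.MathematicalPhysics.QuantumFieldTheory.Balaban1983to89.T4CovarianceResponse

open B15.BasicStep T4DressingDefect T4FirstOrderSize T4CoReadMoment T4TiltModulus

/-! ## §1  The exponential interpolation of a density and the response identity (abstract, Mathlib only) -/

section Abstract

variable {S : Type*} [MeasurableSpace S] {ν : Measure S} {E : Type*} [NormedAddCommGroup E] [NormedSpace ℝ E]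
variable {q₀ g : S → ℝ}

omit [MeasurableSpace S] in
/-- THE EXPONENTIAL INTERPOLATION (exponential family) through a reference density `q₀` with exponent `g`:
`q_θ = q₀·e^{−θg}`; `q_0 = q₀`, `q_1 = q₀e^{−g}`. [folklore] -/
def expTilt (q₀ g : S → ℝ) (θ : ℝ) : S → ℝ := fun s => q₀ s * Real.exp (-(θ * g s))

omit [MeasurableSpace S] in
/-- Unfolding lemma. [folklore] -/
theorem expTilt_apply (q₀ g : S → ℝ) (θ : ℝ) (s : S) : expTilt q₀ g θ s = q₀ s * Real.exp (-(θ * g s)) := rfl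

omit [MeasurableSpace S] in
/-- At `θ = 0` the interpolant is the reference density. [folklore] -/
@[simp] theorem expTilt_zero (q₀ g : S → ℝ) : expTilt q₀ g 0 = q₀ := by
  funext s; rw [expTilt_apply, zero_mul, neg_zero, Real.exp_zero, mul_one]

omit [MeasurableSpace S] in
/-- With the zero exponent the path is constant. [folklore] -/
theorem expTilt_const_zero (q₀ : S → ℝ) (θ : ℝ) : expTilt q₀ (fun _ => 0) θ = q₀ := by
  funext s; rw [expTilt_apply, mul_zero, neg_zero, Real.exp_zero, mul_one]

omit [MeasurableSpace S] in
/-- The interpolants of a non-negative density are non-negative. [folklore] -/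
theorem expTilt_nonneg (hq : ∀ s, 0 ≤ q₀ s) (g : S → ℝ) (θ : ℝ) (s : S) : 0 ≤ expTilt q₀ g θ s :=
  mul_nonneg (hq s) (Real.exp_nonneg _)

omit [MeasurableSpace S] in
/-- `|θ·g| ≤ |θ|·K` under `|g| ≤ K`. [folklore] -/
theorem abs_mul_le_of_abs_le {K : ℝ} (hK : ∀ s, |g s| ≤ K) (θ : ℝ) (s : S) : |θ * g s| ≤ |θ| * K := by
  rw [abs_mul]; exact mul_le_mul_of_nonneg_left (hK s) (abs_nonneg _)

omit [MeasurableSpace S] in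
/-- Upper control of the interpolant: `q_θ ≤ e^{|θ|K}·q₀`. [folklore] -/
theorem expTilt_le (hq : ∀ s, 0 ≤ q₀ s) {K : ℝ} (hK : ∀ s, |g s| ≤ K) (θ : ℝ) (s : S) :
    expTilt q₀ g θ s ≤ Real.exp (|θ| * K) * q₀ s := by
  rw [expTilt_apply, mul_comm]
  exact mul_le_mul_of_nonneg_right
    (Real.exp_le_exp.2 ((neg_le_abs _).trans (abs_mul_le_of_abs_le hK θ s))) (hq s)

omit [MeasurableSpace S] in
/-- Lower control of the interpolant: `e^{−|θ|K}·q₀ ≤ q_θ`. [folklore] -/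
theorem le_expTilt (hq : ∀ s, 0 ≤ q₀ s) {K : ℝ} (hK : ∀ s, |g s| ≤ K) (θ : ℝ) (s : S) :
    Real.exp (-(|θ| * K)) * q₀ s ≤ expTilt q₀ g θ s := by
  rw [expTilt_apply, mul_comm (q₀ s)]
  exact mul_le_mul_of_nonneg_right
    (Real.exp_le_exp.2 (neg_le_neg ((le_abs_self _).trans (abs_mul_le_of_abs_le hK θ s)))) (hq s)

/-- The interpolants of measurable data are measurable. [folklore] -/
theorem measurable_expTilt (hq : Measurable q₀) (hg : Measurable g) (θ : ℝ) : Measurable (expTilt q₀ g θ) :=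
  hq.mul (Real.measurable_exp.comp (hg.const_mul θ).neg)

omit [MeasurableSpace S] in
/-- The `θ`-derivative of the interpolant at a point: `d/dθ (q₀e^{−θg}) = −g·q_θ`. [folklore] -/
theorem hasDerivAt_expTilt (q₀ g : S → ℝ) (s : S) (θ : ℝ) :
    HasDerivAt (fun θ => expTilt q₀ g θ s) (-(g s * expTilt q₀ g θ s)) θ := by
  have h1 : HasDerivAt (fun θ : ℝ => -(θ * g s)) (-(1 * g s)) θ := ((hasDerivAt_id' θ).mul_const (g s)).fun_neg
  refine ((h1.exp).const_mul (q₀ s)).congr_deriv ?_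
  rw [expTilt_apply]; ring

/-- THE STANDING DATA of the interpolation: a measurable reference density `0 ≤ q₀ ≤ C` of POSITIVE integral (the printed
proviso) and a measurable BOUNDED exponent `|g| ≤ K` (the bound enters only qualitatively, caveat (K)). [folklore] -/
structure TiltData (ν : Measure S) (q₀ g : S → ℝ) : Prop where
  /-- the reference density is measurable -/
  measurable_q : Measurable q₀
  /-- … non-negative -/
  nonneg_q : ∀ s, 0 ≤ q₀ s
  /-- … bounded above -/
  bdd_q : ∃ C : ℝ, ∀ s, q₀ s ≤ C
  /-- … of positive integral (the printed proviso) -/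
  pos_q : 0 < ∫ s, q₀ s ∂ν
  /-- the exponent is measurable -/
  measurable_g : Measurable g
  /-- … and bounded -/
  bdd_g : ∃ K : ℝ, ∀ s, |g s| ≤ K

/-- The interpolants are integrable against a finite measure. [folklore] -/
theorem integrable_expTilt [IsFiniteMeasure ν] (h : TiltData ν q₀ g) (θ : ℝ) : Integrable (expTilt q₀ g θ) ν := by
  obtain ⟨C, hC⟩ := h.bdd_q
  obtain ⟨K, hK⟩ := h.bdd_g
  exact integrable_of_abs_le (measurable_expTilt h.measurable_q h.measurable_g θ).aestronglyMeasurable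
    (C := Real.exp (|θ| * K) * C) fun s => by
      rw [abs_of_nonneg (expTilt_nonneg h.nonneg_q g θ s)]
      exact (expTilt_le h.nonneg_q hK θ s).trans (mul_le_mul_of_nonneg_left (hC s) (Real.exp_nonneg _))

/-- The reference density is integrable. [folklore] -/
theorem TiltData.integrable_q [IsFiniteMeasure ν] (h : TiltData ν q₀ g) : Integrable q₀ ν := by
  simpa using integrable_expTilt h 0

/-- THE MASS of the interpolant: `Z(θ) = ∫ q_θ dν`. [folklore] -/
def tiltZ (ν : Measure S) (q₀ g : S → ℝ) (θ : ℝ) : ℝ := ∫ s, expTilt q₀ g θ s ∂ν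

/-- THE UNNORMALISED MEAN of an insert along the path: `N_F(θ) = ∫ q_θ • F dν`. [folklore] -/
def tiltN (ν : Measure S) (q₀ g : S → ℝ) (F : S → E) (θ : ℝ) : E := ∫ s, expTilt q₀ g θ s • F s ∂ν

/-- THE TILTED (PATH) LAW: the normalised law of the interpolant, `(∫q_θ)⁻¹·q_θ dν`. [folklore] -/
def tiltLaw (ν : Measure S) (q₀ g : S → ℝ) (θ : ℝ) : Measure S := normLaw ν (expTilt q₀ g θ)

/-- THE TILTED MEAN `E_θ[F] = ∫F d(tiltLaw θ)` of an insert `F`. [folklore] -/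
def tiltMean (ν : Measure S) (q₀ g : S → ℝ) (F : S → E) (θ : ℝ) : E := ∫ s, F s ∂tiltLaw ν q₀ g θ

/-- THE PATH COVARIANCE of the exponent with an insert: `Cov_θ(g, F) = E_θ[(g − E_θ g) • (F − E_θ F)]`. [folklore] -/
def tiltCov (ν : Measure S) (q₀ g : S → ℝ) (F : S → E) (θ : ℝ) : E :=
  ∫ s, (g s - tiltMean ν q₀ g g θ) • (F s - tiltMean ν q₀ g F θ) ∂tiltLaw ν q₀ g θ

/-- THE PATH VARIANCE of an insert: `Var_θ(F) = E_θ‖F − E_θ F‖²` (for `F = g`: the variance of the exponent). [folklore] -/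
def tiltVar (ν : Measure S) (q₀ g : S → ℝ) (F : S → E) (θ : ℝ) : ℝ :=
  ∫ s, ‖F s - tiltMean ν q₀ g F θ‖ ^ 2 ∂tiltLaw ν q₀ g θ

/-- The mass of every interpolant is POSITIVE: `Z(θ) ≥ e^{−|θ|K}∫q₀ > 0`. [folklore] -/
theorem tiltZ_pos [IsFiniteMeasure ν] (h : TiltData ν q₀ g) (θ : ℝ) : 0 < tiltZ ν q₀ g θ := by
  obtain ⟨K, hK⟩ := h.bdd_g
  have hle : Real.exp (-(|θ| * K)) * ∫ s, q₀ s ∂ν ≤ tiltZ ν q₀ g θ := by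
    rw [tiltZ, ← integral_const_mul]
    exact integral_mono (h.integrable_q.const_mul _) (integrable_expTilt h θ) fun s => le_expTilt h.nonneg_q hK θ s
  exact lt_of_lt_of_le (mul_pos (Real.exp_pos _) h.pos_q) hle

/-- At `θ = 0` the path law is the normalised law of the reference density. [folklore] -/
@[simp] theorem tiltLaw_zero (ν : Measure S) (q₀ g : S → ℝ) : tiltLaw ν q₀ g 0 = normLaw ν q₀ := by
  rw [tiltLaw, expTilt_zero]

/-- … so the tilted mean at `θ = 0` is the reference mean. [folklore] -/
theorem tiltMean_zero (ν : Measure S) (q₀ g : S → ℝ) (F : S → E) :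
    tiltMean ν q₀ g F 0 = ∫ s, F s ∂normLaw ν q₀ := by
  rw [tiltMean, tiltLaw_zero]

/-- … and at `θ = 1` it is the mean under the normalised law of `q₀e^{−g}`. [folklore] -/
theorem tiltMean_one (ν : Measure S) (q₀ g : S → ℝ) (F : S → E) :
    tiltMean ν q₀ g F 1 = ∫ s, F s ∂normLaw ν (fun s => q₀ s * Real.exp (-g s)) := by
  have h1 : expTilt q₀ g 1 = fun s => q₀ s * Real.exp (-g s) := funext fun s => by rw [expTilt_apply, one_mul]
  rw [tiltMean, tiltLaw, h1]

/-- A normalised law of a non-negative integrable density of POSITIVE integral is a probability measure. [folklore] -/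
theorem isProbabilityMeasure_normLaw {p : S → ℝ} (hp0 : 0 ≤ p) (hpi : Integrable p ν) (hpos : 0 < ∫ s, p s ∂ν) :
    IsProbabilityMeasure (normLaw ν p) := by
  refine ⟨?_⟩
  rw [normLaw, Measure.smul_apply, smul_eq_mul, withDensity_ofReal_univ hp0 hpi]
  exact ENNReal.inv_mul_cancel (ENNReal.ofReal_pos.2 hpos).ne' ENNReal.ofReal_ne_top

/-- Every path law is a probability measure. [folklore] -/
theorem isProbabilityMeasure_tiltLaw [IsFiniteMeasure ν] (h : TiltData ν q₀ g) (θ : ℝ) :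
    IsProbabilityMeasure (tiltLaw ν q₀ g θ) :=
  isProbabilityMeasure_normLaw (fun s => expTilt_nonneg h.nonneg_q g θ s) (integrable_expTilt h θ) (tiltZ_pos h θ)

/-- Every path law is absolutely continuous with respect to the base measure. [folklore] -/
theorem tiltLaw_absolutelyContinuous (ν : Measure S) (q₀ g : S → ℝ) (θ : ℝ) : tiltLaw ν q₀ g θ ≪ ν := by
  rw [tiltLaw, normLaw]
  exact (withDensity_absolutelyContinuous _ _).smul_left _

/-- (R1) THE TILTED MEAN AS A QUOTIENT: `E_θ F = Z(θ)⁻¹ • ∫ q_θ • F dν`. [folklore] -/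
theorem tiltMean_eq_smul [IsFiniteMeasure ν] (h : TiltData ν q₀ g) (F : S → E) (θ : ℝ) :
    tiltMean ν q₀ g F θ = (tiltZ ν q₀ g θ)⁻¹ • tiltN ν q₀ g F θ := by
  rw [tiltMean, tiltLaw, tiltN,
    integral_normLaw (measurable_expTilt h.measurable_q h.measurable_g θ) (fun s => expTilt_nonneg h.nonneg_q g θ s)
      (integrable_expTilt h θ), ← integral_smul]
  refine integral_congr_ae (ae_of_all _ fun s => ?_)
  dsimp only
  rw [div_eq_inv_mul, mul_smul, tiltZ]

omit [MeasurableSpace S] in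
/-- The dominating constant of the `θ`-derivatives on the unit ball of parameters about `θ₀`:
`‖−g·q_θ‖ ≤ K·(e^{(|θ₀|+1)K}·C)` for `|θ − θ₀| < 1`. [folklore] -/
theorem norm_deriv_expTilt_le (hq : ∀ s, 0 ≤ q₀ s) {C : ℝ} (hC : ∀ s, q₀ s ≤ C) {K : ℝ} (hK : ∀ s, |g s| ≤ K)
    {θ₀ θ : ℝ} (hθ : θ ∈ Metric.ball θ₀ 1) (s : S) :
    ‖-(g s * expTilt q₀ g θ s)‖ ≤ K * (Real.exp ((|θ₀| + 1) * K) * C) := by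
  have hK0 : 0 ≤ K := (abs_nonneg _).trans (hK s)
  have hθ' : |θ| ≤ |θ₀| + 1 := by
    have h1 : |θ - θ₀| < 1 := by rw [← Real.dist_eq]; exact Metric.mem_ball.1 hθ
    linarith [abs_sub_abs_le_abs_sub θ θ₀]
  rw [norm_neg, norm_mul, Real.norm_eq_abs, Real.norm_eq_abs, abs_of_nonneg (expTilt_nonneg hq g θ s)]
  calc |g s| * expTilt q₀ g θ s ≤ K * (Real.exp (|θ| * K) * q₀ s) :=
        mul_le_mul (hK s) (expTilt_le hq hK θ s) (expTilt_nonneg hq g θ s) hK0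
    _ ≤ K * (Real.exp ((|θ₀| + 1) * K) * C) :=
        mul_le_mul_of_nonneg_left (mul_le_mul (Real.exp_le_exp.2 (mul_le_mul_of_nonneg_right hθ' hK0)) (hC s)
          (hq s) (Real.exp_nonneg _)) hK0

omit [MeasurableSpace S] in
/-- The same constant for Banach-valued inserts `‖F‖ ≤ R`: `‖(−g·q_θ) • F‖ ≤ K·(e^{(|θ₀|+1)K}·C)·R`. [folklore] -/
theorem norm_deriv_expTilt_smul_le (hq : ∀ s, 0 ≤ q₀ s) {C : ℝ} (hC : ∀ s, q₀ s ≤ C) {K : ℝ}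
    (hK : ∀ s, |g s| ≤ K) {θ₀ θ : ℝ} (hθ : θ ∈ Metric.ball θ₀ 1) {F : S → E} {R : ℝ} (hR : ∀ s, ‖F s‖ ≤ R)
    (s : S) : ‖(-(g s * expTilt q₀ g θ s)) • F s‖ ≤ K * (Real.exp ((|θ₀| + 1) * K) * C) * R := by
  rw [norm_smul]
  exact mul_le_mul (norm_deriv_expTilt_le hq hC hK hθ s) (hR s) (norm_nonneg _)
    ((norm_nonneg _).trans (norm_deriv_expTilt_le hq hC hK hθ s))

/-- (R2) DIFFERENTIATION OF THE MASS under the integral: `Z′(θ₀) = −∫ q_{θ₀}·g dν`. [folklore] -/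
theorem hasDerivAt_tiltZ [IsFiniteMeasure ν] (h : TiltData ν q₀ g) (θ₀ : ℝ) :
    HasDerivAt (tiltZ ν q₀ g) (-tiltN ν q₀ g g θ₀) θ₀ := by
  obtain ⟨C, hC⟩ := h.bdd_q
  obtain ⟨K, hK⟩ := h.bdd_g
  have hmeas : ∀ θ, AEStronglyMeasurable (expTilt q₀ g θ) ν := fun θ =>
    (measurable_expTilt h.measurable_q h.measurable_g θ).aestronglyMeasurable
  have hmeas' : AEStronglyMeasurable (fun s => -(g s * expTilt q₀ g θ₀ s)) ν :=
    ((h.measurable_g.mul (measurable_expTilt h.measurable_q h.measurable_g θ₀)).neg).aestronglyMeasurable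
  have h_bound : ∀ᵐ s ∂ν, ∀ θ ∈ Metric.ball θ₀ 1,
      ‖-(g s * expTilt q₀ g θ s)‖ ≤ K * (Real.exp ((|θ₀| + 1) * K) * C) :=
    ae_of_all _ fun s θ hθ => norm_deriv_expTilt_le h.nonneg_q hC hK hθ s
  have h_diff : ∀ᵐ s ∂ν, ∀ θ ∈ Metric.ball θ₀ 1,
      HasDerivAt (fun θ => expTilt q₀ g θ s) (-(g s * expTilt q₀ g θ s)) θ :=
    ae_of_all _ fun s θ _ => hasDerivAt_expTilt q₀ g s θ
  obtain ⟨-, key⟩ := hasDerivAt_integral_of_dominated_loc_of_deriv_le (F := expTilt q₀ g)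
    (F' := fun θ s => -(g s * expTilt q₀ g θ s)) (Metric.ball_mem_nhds θ₀ zero_lt_one)
    (Filter.Eventually.of_forall hmeas) (integrable_expTilt h θ₀) hmeas' h_bound (integrable_const _) h_diff
  have hval : ∫ s, -(g s * expTilt q₀ g θ₀ s) ∂ν = -tiltN ν q₀ g g θ₀ := by
    rw [integral_neg, tiltN]
    congr 1
    exact integral_congr_ae (ae_of_all _ fun s => by simp only [smul_eq_mul, mul_comm])
  rw [← hval]
  exact key

/-- (R2) DIFFERENTIATION OF THE UNNORMALISED MEAN under the integral: `N_F′(θ₀) = −∫ q_{θ₀} • (g•F) dν` for a bounded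
a.e.-strongly-measurable insert. [folklore] -/
theorem hasDerivAt_tiltN [IsFiniteMeasure ν] (h : TiltData ν q₀ g) {F : S → E} (hF : AEStronglyMeasurable F ν) {R : ℝ}
    (hR : ∀ s, ‖F s‖ ≤ R) (θ₀ : ℝ) :
    HasDerivAt (tiltN ν q₀ g F) (-tiltN ν q₀ g (fun s => g s • F s) θ₀) θ₀ := by
  obtain ⟨C, hC⟩ := h.bdd_q
  obtain ⟨K, hK⟩ := h.bdd_g
  have hFtop : MemLp F ∞ ν := memLp_top_of_bound hF R (ae_of_all _ hR)
  have hmeas : ∀ θ, AEStronglyMeasurable (fun s => expTilt q₀ g θ s • F s) ν := fun θ =>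
    (measurable_expTilt h.measurable_q h.measurable_g θ).aestronglyMeasurable.smul hF
  have hint : Integrable (fun s => expTilt q₀ g θ₀ s • F s) ν := (integrable_expTilt h θ₀).smul_of_top_left hFtop
  have hmeas' : AEStronglyMeasurable (fun s => (-(g s * expTilt q₀ g θ₀ s)) • F s) ν :=
    ((h.measurable_g.mul (measurable_expTilt h.measurable_q h.measurable_g θ₀)).neg).aestronglyMeasurable.smul hF
  have h_bound : ∀ᵐ s ∂ν, ∀ θ ∈ Metric.ball θ₀ 1,
      ‖(-(g s * expTilt q₀ g θ s)) • F s‖ ≤ K * (Real.exp ((|θ₀| + 1) * K) * C) * R :=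
    ae_of_all _ fun s θ hθ => norm_deriv_expTilt_smul_le h.nonneg_q hC hK hθ hR s
  have h_diff : ∀ᵐ s ∂ν, ∀ θ ∈ Metric.ball θ₀ 1,
      HasDerivAt (fun θ => expTilt q₀ g θ s • F s) ((-(g s * expTilt q₀ g θ s)) • F s) θ :=
    ae_of_all _ fun s θ _ => (hasDerivAt_expTilt q₀ g s θ).smul_const (F s)
  obtain ⟨-, key⟩ := hasDerivAt_integral_of_dominated_loc_of_deriv_le (F := fun θ s => expTilt q₀ g θ s • F s)
    (F' := fun θ s => (-(g s * expTilt q₀ g θ s)) • F s) (Metric.ball_mem_nhds θ₀ zero_lt_one)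
    (Filter.Eventually.of_forall hmeas) hint hmeas' h_bound (integrable_const _) h_diff
  have hval : ∫ s, (-(g s * expTilt q₀ g θ₀ s)) • F s ∂ν = -tiltN ν q₀ g (fun s => g s • F s) θ₀ := by
    rw [tiltN, ← integral_neg]
    exact integral_congr_ae (ae_of_all _ fun s => by simp only [neg_smul, smul_smul, mul_comm])
  rw [← hval]
  exact key

/-- THE COVARIANCE IDENTITY on a probability space: `E[(g − Eg) • (F − EF)] = E[g•F] − Eg • EF`. [folklore] -/
theorem integral_sub_smul_sub [CompleteSpace E] {p : Measure S} [IsProbabilityMeasure p] {g : S → ℝ} {F : S → E}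
    (hg : Integrable g p) (hF : Integrable F p) (hgF : Integrable (fun s => g s • F s) p) :
    ∫ s, (g s - ∫ t, g t ∂p) • (F s - ∫ t, F t ∂p) ∂p = (∫ s, g s • F s ∂p) - (∫ t, g t ∂p) • ∫ t, F t ∂p := by
  have h1 : (fun s => (g s - ∫ t, g t ∂p) • (F s - ∫ t, F t ∂p)) =
      fun s => (g s • F s - g s • ∫ t, F t ∂p) - ((∫ t, g t ∂p) • F s - (∫ t, g t ∂p) • ∫ t, F t ∂p) :=
    funext fun s => by rw [sub_smul, smul_sub, smul_sub]
  have i1 : Integrable (fun s => g s • ∫ t, F t ∂p) p := hg.smul_const _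
  have i2 : Integrable (fun s => (∫ t, g t ∂p) • F s) p := hF.smul _
  have i3 : Integrable (fun _ : S => (∫ t, g t ∂p) • ∫ t, F t ∂p) p := integrable_const _
  have j1 : Integrable (fun s => g s • F s - g s • ∫ t, F t ∂p) p := hgF.sub i1
  have j2 : Integrable (fun s => (∫ t, g t ∂p) • F s - (∫ t, g t ∂p) • ∫ t, F t ∂p) p := i2.sub i3
  rw [h1, integral_sub j1 j2, integral_sub hgF i1, integral_sub i2 i3, integral_smul_const, integral_smul,
    integral_const, probReal_univ, one_smul, sub_self, sub_zero]

/-- (R2′) CENTRED = UNCENTRED path covariance: `Cov_θ(g, F) = E_θ[g•F] − E_θ g • E_θ F`. [folklore] -/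
theorem tiltCov_eq_sub [CompleteSpace E] [IsFiniteMeasure ν] (h : TiltData ν q₀ g) {F : S → E}
    (hF : AEStronglyMeasurable F ν) {R : ℝ} (hR : ∀ s, ‖F s‖ ≤ R) (θ : ℝ) :
    tiltCov ν q₀ g F θ =
      tiltMean ν q₀ g (fun s => g s • F s) θ - tiltMean ν q₀ g g θ • tiltMean ν q₀ g F θ := by
  obtain ⟨K, hK⟩ := h.bdd_g
  haveI := isProbabilityMeasure_tiltLaw h θ
  have hac := tiltLaw_absolutelyContinuous ν q₀ g θ
  have hFtop : MemLp F ∞ (tiltLaw ν q₀ g θ) := memLp_top_of_bound (hF.mono_ac hac) R (ae_of_all _ hR)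
  have ig : Integrable g (tiltLaw ν q₀ g θ) := integrable_of_abs_le h.measurable_g.aestronglyMeasurable hK
  unfold tiltCov tiltMean
  exact integral_sub_smul_sub ig (hFtop.integrable le_top) (ig.smul_of_top_left hFtop)

/-- (R2) **THE RESPONSE IDENTITY.**  The tilted mean of a bounded insert is differentiable in the interpolation parameter
with derivative MINUS THE PATH COVARIANCE with the exponent: `d/dθ E_θ[F] = −Cov_θ(g, F)`. [folklore] -/
theorem hasDerivAt_tiltMean [CompleteSpace E] [IsFiniteMeasure ν] (h : TiltData ν q₀ g) {F : S → E}
    (hF : AEStronglyMeasurable F ν) {R : ℝ} (hR : ∀ s, ‖F s‖ ≤ R) (θ₀ : ℝ) :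
    HasDerivAt (tiltMean ν q₀ g F) (-tiltCov ν q₀ g F θ₀) θ₀ := by
  obtain ⟨K, hK⟩ := h.bdd_g
  have hfun : tiltMean ν q₀ g F = fun θ => (tiltZ ν q₀ g θ)⁻¹ • tiltN ν q₀ g F θ :=
    funext fun θ => tiltMean_eq_smul h F θ
  have hg' : AEStronglyMeasurable g ν := h.measurable_g.aestronglyMeasurable
  have hKn : ∀ s, ‖g s‖ ≤ K := fun s => by rw [Real.norm_eq_abs]; exact hK s
  have key := ((hasDerivAt_tiltZ h θ₀).fun_inv (tiltZ_pos h θ₀).ne').fun_smul (hasDerivAt_tiltN h hF hR θ₀)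
  rw [hfun]
  refine key.congr_deriv ?_
  rw [tiltCov_eq_sub h hF hR θ₀, tiltMean_eq_smul h (fun s => g s • F s) θ₀, tiltMean_eq_smul h F θ₀,
    tiltMean_eq_smul h g θ₀]
  simp only [smul_eq_mul, smul_smul, neg_neg, smul_neg, neg_sub]
  rw [show tiltN ν q₀ g g θ₀ / tiltZ ν q₀ g θ₀ ^ 2 =
      (tiltZ ν q₀ g θ₀)⁻¹ * tiltN ν q₀ g g θ₀ * (tiltZ ν q₀ g θ₀)⁻¹ by ring]
  abel

/-- CAUCHY–SCHWARZ for a scalar-times-vector covariance integrand on a finite measure space: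
`‖∫ (g − a) • (F − b)‖ ≤ (∫‖g − a‖²)^{1/2}·(∫‖F − b‖²)^{1/2}` for bounded data and arbitrary centres. [folklore] -/
theorem norm_integral_sub_smul_sub_le {p : Measure S} [IsFiniteMeasure p] {g : S → ℝ} {F : S → E}
    (hg : AEStronglyMeasurable g p) (hF : AEStronglyMeasurable F p) {K R : ℝ} (hK : ∀ s, |g s| ≤ K)
    (hR : ∀ s, ‖F s‖ ≤ R) (a : ℝ) (b : E) :
    ‖∫ s, (g s - a) • (F s - b) ∂p‖ ≤
      Real.sqrt (∫ s, ‖g s - a‖ ^ 2 ∂p) * Real.sqrt (∫ s, ‖F s - b‖ ^ 2 ∂p) := by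
  have m1 : AEStronglyMeasurable (fun s => ‖g s - a‖) p := (hg.sub aestronglyMeasurable_const).norm
  have m2 : AEStronglyMeasurable (fun s => ‖F s - b‖) p := (hF.sub aestronglyMeasurable_const).norm
  have hgK : ∀ s, ‖g s‖ ≤ K := fun s => by rw [Real.norm_eq_abs]; exact hK s
  have b1 : ∀ s, ‖‖g s - a‖‖ ≤ K + ‖a‖ := fun s => by
    rw [norm_norm]; exact (norm_sub_le _ _).trans (add_le_add (hgK s) le_rfl)
  have b2 : ∀ s, ‖‖F s - b‖‖ ≤ R + ‖b‖ := fun s => by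
    rw [norm_norm]; exact (norm_sub_le _ _).trans (add_le_add (hR s) le_rfl)
  have l1 : MemLp (fun s => ‖g s - a‖) (ENNReal.ofReal 2) p := MemLp.of_bound m1 _ (ae_of_all _ b1)
  have l2 : MemLp (fun s => ‖F s - b‖) (ENNReal.ofReal 2) p := MemLp.of_bound m2 _ (ae_of_all _ b2)
  have hcs := integral_mul_le_Lp_mul_Lq_of_nonneg Real.HolderConjugate.two_two
    (ae_of_all _ fun s => norm_nonneg (g s - a)) (ae_of_all _ fun s => norm_nonneg (F s - b)) l1 l2
  simp only [Real.rpow_two, ← Real.sqrt_eq_rpow] at hcs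
  calc ‖∫ s, (g s - a) • (F s - b) ∂p‖ ≤ ∫ s, ‖(g s - a) • (F s - b)‖ ∂p := norm_integral_le_integral_norm _
    _ = ∫ s, ‖g s - a‖ * ‖F s - b‖ ∂p := by simp only [norm_smul]
    _ ≤ Real.sqrt (∫ s, ‖g s - a‖ ^ 2 ∂p) * Real.sqrt (∫ s, ‖F s - b‖ ^ 2 ∂p) := hcs

/-- (R3) CAUCHY–SCHWARZ FOR THE PATH COVARIANCE: `‖Cov_θ(g, F)‖ ≤ √Var_θ(g)·√Var_θ(F)`. [folklore] -/
theorem norm_tiltCov_le [IsFiniteMeasure ν] (h : TiltData ν q₀ g) {F : S → E} (hF : AEStronglyMeasurable F ν)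
    {R : ℝ} (hR : ∀ s, ‖F s‖ ≤ R) (θ : ℝ) :
    ‖tiltCov ν q₀ g F θ‖ ≤ Real.sqrt (tiltVar ν q₀ g g θ) * Real.sqrt (tiltVar ν q₀ g F θ) := by
  obtain ⟨K, hK⟩ := h.bdd_g
  haveI := isProbabilityMeasure_tiltLaw h θ
  have hac := tiltLaw_absolutelyContinuous ν q₀ g θ
  unfold tiltCov tiltVar
  exact norm_integral_sub_smul_sub_le h.measurable_g.aestronglyMeasurable (hF.mono_ac hac) hK hR _ _

/-- (R4) **THE RESPONSE BOUND.**  Variance bounds along the path on `θ ∈ [0,1]` — `Var_θ(g) ≤ Vg`, `Var_θ(F) ≤ VF`, both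
INPUTS (caveat (VAR)) — give `‖E₁[F] − E₀[F]‖ ≤ √Vg·√VF` (response identity + Cauchy–Schwarz + mean value inequality).
The sup bound `K` of the exponent does not enter. [folklore] -/
theorem norm_tiltMean_one_sub_zero_le [CompleteSpace E] [IsFiniteMeasure ν] (h : TiltData ν q₀ g) {F : S → E}
    (hF : AEStronglyMeasurable F ν) {R : ℝ} (hR : ∀ s, ‖F s‖ ≤ R) {Vg VF : ℝ}
    (hVg : ∀ θ ∈ Set.Icc (0 : ℝ) 1, tiltVar ν q₀ g g θ ≤ Vg) (hVF : ∀ θ ∈ Set.Icc (0 : ℝ) 1, tiltVar ν q₀ g F θ ≤ VF) :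
    ‖tiltMean ν q₀ g F 1 - tiltMean ν q₀ g F 0‖ ≤ Real.sqrt Vg * Real.sqrt VF :=
  norm_image_sub_le_of_norm_deriv_le_segment_01' (f' := fun θ => -tiltCov ν q₀ g F θ)
    (fun θ _ => (hasDerivAt_tiltMean h hF hR θ).hasDerivWithinAt) fun θ hθ => by
      rw [norm_neg]
      exact (norm_tiltCov_le h hF hR θ).trans (mul_le_mul (Real.sqrt_le_sqrt (hVg θ (Set.Ico_subset_Icc_self hθ)))
        (Real.sqrt_le_sqrt (hVF θ (Set.Ico_subset_Icc_self hθ))) (Real.sqrt_nonneg _) (Real.sqrt_nonneg _))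

/-- THE VARIANCE IS THE LEAST SECOND MOMENT (real case): on a probability space, for bounded measurable `g` and any
centre `κ`, `∫(g − ∫g)² ≤ ∫(g − κ)²`. [folklore] -/
theorem integral_sq_sub_integral_le {p : Measure S} [IsProbabilityMeasure p] {g : S → ℝ}
    (hg : AEStronglyMeasurable g p) {K : ℝ} (hK : ∀ s, |g s| ≤ K) (κ : ℝ) :
    ∫ s, ‖g s - ∫ t, g t ∂p‖ ^ 2 ∂p ≤ ∫ s, ‖g s - κ‖ ^ 2 ∂p := by
  have ig : Integrable g p := integrable_of_abs_le hg hK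
  have igκ : Integrable (fun s => g s - κ) p := ig.sub (integrable_const κ)
  have igκ2 : Integrable (fun s => (g s - κ) ^ 2) p := by
    refine integrable_of_abs_le ((continuous_pow 2).comp_aestronglyMeasurable igκ.aestronglyMeasurable)
      (C := (K + |κ|) ^ 2) fun s => ?_
    show |(g s - κ) ^ 2| ≤ (K + |κ|) ^ 2
    rw [abs_pow]
    exact pow_le_pow_left₀ (abs_nonneg _) ((abs_sub (g s) κ).trans (add_le_add (hK s) le_rfl)) 2
  have hmean : ∫ t, g t ∂p - κ = ∫ t, (g t - κ) ∂p := by rw [integral_sub ig (integrable_const κ), integral_const,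
    probReal_univ, one_smul]
  have hexp : (fun s => ‖g s - ∫ t, g t ∂p‖ ^ 2) = fun s =>
      (g s - κ) ^ 2 - (2 * (∫ t, (g t - κ) ∂p)) * (g s - κ) + (∫ t, (g t - κ) ∂p) ^ 2 := funext fun s => by
    rw [Real.norm_eq_abs, sq_abs, show g s - ∫ t, g t ∂p = (g s - κ) - (∫ t, g t ∂p - κ) by ring, hmean]; ring
  have j0 : Integrable (fun s => (2 * ∫ t, (g t - κ) ∂p) * (g s - κ)) p := igκ.const_mul _
  have j1 : Integrable (fun s => (g s - κ) ^ 2 - (2 * ∫ t, (g t - κ) ∂p) * (g s - κ)) p := igκ2.sub j0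
  have j2 : Integrable (fun _ : S => (∫ t, (g t - κ) ∂p) ^ 2) p := integrable_const _
  rw [hexp, integral_add j1 j2, integral_sub igκ2 j0, integral_const_mul, integral_const, probReal_univ, one_smul]
  simp_rw [Real.norm_eq_abs, sq_abs]
  nlinarith [sq_nonneg (∫ t, (g t - κ) ∂p)]

/-- (R5a) PATH VARIANCE OF THE EXPONENT ≤ OSCILLATION²: `|g − κ| ≤ ε` pointwise (free constant `κ`) gives
`Var_θ(g) ≤ ε²` for every `θ`. [folklore] -/
theorem tiltVar_le_of_abs_sub_le [IsFiniteMeasure ν] (h : TiltData ν q₀ g) {κ ε : ℝ} (hε : ∀ s, |g s - κ| ≤ ε)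
    (θ : ℝ) : tiltVar ν q₀ g g θ ≤ ε ^ 2 := by
  obtain ⟨K, hK⟩ := h.bdd_g
  haveI := isProbabilityMeasure_tiltLaw h θ
  have hg : AEStronglyMeasurable g (tiltLaw ν q₀ g θ) := h.measurable_g.aestronglyMeasurable
  unfold tiltVar tiltMean
  refine (integral_sq_sub_integral_le hg hK κ).trans ?_
  calc ∫ s, ‖g s - κ‖ ^ 2 ∂tiltLaw ν q₀ g θ ≤ ∫ _, ε ^ 2 ∂tiltLaw ν q₀ g θ := by
        refine integral_mono_of_nonneg (ae_of_all _ fun s => sq_nonneg _) (integrable_const _)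
          (ae_of_all _ fun s => ?_)
        show ‖g s - κ‖ ^ 2 ≤ ε ^ 2
        rw [Real.norm_eq_abs, ← sq_abs ε]
        exact pow_le_pow_left₀ (abs_nonneg _) ((hε s).trans (le_abs_self ε)) 2
    _ = ε ^ 2 := by rw [integral_const, probReal_univ, one_smul]

/-- The mean of a bounded insert is within `M` of any centre `c` with `‖F − c‖ ≤ M` (probability space). [folklore] -/
theorem norm_integral_sub_le_of_norm_sub_le [CompleteSpace E] {p : Measure S} [IsProbabilityMeasure p] {F : S → E}
    (hF : Integrable F p) {c : E} {M : ℝ} (hM : ∀ s, ‖F s - c‖ ≤ M) : ‖(∫ s, F s ∂p) - c‖ ≤ M := by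
  have h1 : (∫ s, F s ∂p) - c = ∫ s, (F s - c) ∂p := by
    rw [integral_sub hF (integrable_const c), integral_const, probReal_univ, one_smul]
  rw [h1]
  calc ‖∫ s, (F s - c) ∂p‖ ≤ M * p.real Set.univ := norm_integral_le_of_norm_le_const (ae_of_all _ hM)
    _ = M := by rw [probReal_univ, mul_one]

/-- (R5b) PATH VARIANCE OF A BANACH-VALUED INSERT ≤ (2·OSCILLATION)²: `‖F − c‖ ≤ M` pointwise (free centre `c`) gives
`Var_θ(F) ≤ (2M)²` for every `θ` (the factor `2`: no inner product is assumed on `E`). [folklore] -/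
theorem tiltVar_le_of_norm_sub_le [CompleteSpace E] [IsFiniteMeasure ν] (h : TiltData ν q₀ g) {F : S → E}
    (hF : AEStronglyMeasurable F ν) {c : E} {M : ℝ} (hM : ∀ s, ‖F s - c‖ ≤ M) (θ : ℝ) :
    tiltVar ν q₀ g F θ ≤ (2 * M) ^ 2 := by
  haveI := isProbabilityMeasure_tiltLaw h θ
  have hac := tiltLaw_absolutelyContinuous ν q₀ g θ
  have hbd : ∀ s, ‖F s‖ ≤ M + ‖c‖ := fun s =>
    calc ‖F s‖ = ‖(F s - c) + c‖ := by rw [sub_add_cancel]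
      _ ≤ ‖F s - c‖ + ‖c‖ := norm_add_le _ _
      _ ≤ M + ‖c‖ := add_le_add (hM s) le_rfl
  have iF : Integrable F (tiltLaw ν q₀ g θ) :=
    (memLp_top_of_bound (hF.mono_ac hac) (M + ‖c‖) (ae_of_all _ hbd)).integrable le_top
  have hdev : ∀ s, ‖F s - tiltMean ν q₀ g F θ‖ ≤ 2 * M := fun s => by
    calc ‖F s - tiltMean ν q₀ g F θ‖ = ‖(F s - c) - (tiltMean ν q₀ g F θ - c)‖ := by rw [sub_sub_sub_cancel_right]
      _ ≤ ‖F s - c‖ + ‖tiltMean ν q₀ g F θ - c‖ := norm_sub_le _ _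
      _ ≤ M + M := add_le_add (hM s) (norm_integral_sub_le_of_norm_sub_le iF hM)
      _ = 2 * M := by ring
  calc tiltVar ν q₀ g F θ = ∫ s, ‖F s - tiltMean ν q₀ g F θ‖ ^ 2 ∂tiltLaw ν q₀ g θ := rfl
    _ ≤ ∫ _, (2 * M) ^ 2 ∂tiltLaw ν q₀ g θ :=
        integral_mono_of_nonneg (ae_of_all _ fun s => sq_nonneg _) (integrable_const _)
          (ae_of_all _ fun s => pow_le_pow_left₀ (norm_nonneg _) (hdev s) 2)
    _ = (2 * M) ^ 2 := by rw [integral_const, probReal_univ, one_smul]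

/-- (R5) **THE OSCILLATION FORM OF THE RESPONSE BOUND** (unconditional): `|g − κ| ≤ ε` and `‖F − c‖ ≤ M` pointwise, for
free constants `κ`, `c`, give `‖E₁[F] − E₀[F]‖ ≤ ε·(2M)`.  For the same data the tilt modulus of
`T4TiltModulus.norm_integral_normLaw_sub_le` reads `(e^{2ε} − 1)·M ≥ 2εM`: the exponential is gone. [folklore] -/
theorem norm_tiltMean_one_sub_zero_le_of_osc [CompleteSpace E] [IsFiniteMeasure ν] (h : TiltData ν q₀ g) {F : S → E}
    (hF : AEStronglyMeasurable F ν) {κ ε : ℝ} (hε : ∀ s, |g s - κ| ≤ ε) (hε0 : 0 ≤ ε) {c : E} {M : ℝ}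
    (hM : ∀ s, ‖F s - c‖ ≤ M) (hM0 : 0 ≤ M) :
    ‖tiltMean ν q₀ g F 1 - tiltMean ν q₀ g F 0‖ ≤ ε * (2 * M) := by
  have hbd : ∀ s, ‖F s‖ ≤ M + ‖c‖ := fun s =>
    calc ‖F s‖ = ‖(F s - c) + c‖ := by rw [sub_add_cancel]
      _ ≤ ‖F s - c‖ + ‖c‖ := norm_add_le _ _
      _ ≤ M + ‖c‖ := add_le_add (hM s) le_rfl
  have key := norm_tiltMean_one_sub_zero_le h hF hbd (fun θ _ => tiltVar_le_of_abs_sub_le h hε θ)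
    fun θ _ => tiltVar_le_of_norm_sub_le h hF hM θ
  rwa [Real.sqrt_sq hε0, Real.sqrt_sq (mul_nonneg zero_le_two hM0)] at key

omit [MeasurableSpace S] in
/-- DOMINANCE, kernel-checked: the oscillation form `ε·(2M)` never exceeds the tilt modulus `(e^{2ε} − 1)·M` of
`T4TiltModulus.norm_integral_normLaw_sub_le` (any real `ε`, `0 ≤ M`; from `1 + x ≤ eˣ`). [folklore] -/
theorem osc_bound_le_tilt_bound {ε M : ℝ} (hM : 0 ≤ M) : ε * (2 * M) ≤ (Real.exp (2 * ε) - 1) * M := by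
  have h1 : 2 * ε + 1 ≤ Real.exp (2 * ε) := Real.add_one_le_exp _
  nlinarith

end Abstract

/-! ## §2  The fibre: two conditional laws as the endpoints of one exponential interpolation -/

section Fibre

variable {P : Params} {j : ℕ} {G : Type*} [GaugeGroup G] [MeasurableSpace G] [HaarData G]
variable [DecidableEq (PBond P j)]
variable {E : Type*} [NormedAddCommGroup E] [NormedSpace ℝ E]

omit [GaugeGroup G] [MeasurableSpace G] [HaarData G] in
/-- THE EXPONENT GAP between the reference exterior `u₀` and the exterior `u` on the fibre through `s`:
`y ↦ h(u₀←y) − h(u←y)` (`u←y := updateFinset u s y`).  Its oscillation about a constant is the `ε` of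
`T4TiltModulus.fibreRatioClose_of_exp`; its size for Bałaban's exponents is NOT this module's (caveat (LOG)). [folklore] -/
def expGap (s : Finset (PBond P j)) (h : Density P j G) (u₀ u : GaugeField P j G) : (s → G) → ℝ :=
  fun y => h (updateFinset u₀ s y) - h (updateFinset u s y)

omit [GaugeGroup G] [MeasurableSpace G] [HaarData G] in
/-- Unfolding lemma. [folklore] -/
theorem expGap_apply (s : Finset (PBond P j)) (h : Density P j G) (u₀ u : GaugeField P j G) (y : s → G) :
    expGap s h u₀ u y = h (updateFinset u₀ s y) - h (updateFinset u s y) := rfl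

omit [GaugeGroup G] [MeasurableSpace G] [HaarData G] in
/-- The gap of an exterior with itself vanishes. [folklore] -/
theorem expGap_self (s : Finset (PBond P j)) (h : Density P j G) (u₀ : GaugeField P j G) :
    expGap s h u₀ u₀ = fun _ => 0 := funext fun _ => sub_self _

omit [GaugeGroup G] [MeasurableSpace G] [HaarData G] in
/-- **THE FIBRE DENSITIES OF A GIBBS DENSITY WITH AN EXTERIOR-BLIND WINDOW INTERPOLATE EXPONENTIALLY.**  For
`old = χ·e^{h}` with `χ(u←y) = χ(u₀←y)` on the fibre, the fibre density at `u` is the `θ = 1` interpolant of the fibre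
density at `u₀` with exponent the gap: `old(u←y) = old(u₀←y)·e^{−(h(u₀←y) − h(u←y))}`. [folklore] -/
theorem fibreDensity_eq_expTilt_one (s : Finset (PBond P j)) (χ h : Density P j G) {u₀ u : GaugeField P j G}
    (hbl : ∀ y : s → G, χ (updateFinset u s y) = χ (updateFinset u₀ s y)) :
    fibreDensity s (fun U => χ U * Real.exp (h U)) u =
      expTilt (fibreDensity s (fun U => χ U * Real.exp (h U)) u₀) (expGap s h u₀ u) 1 := by
  funext y
  simp only [fibreDensity, expTilt_apply, expGap_apply, one_mul]
  rw [hbl y, mul_assoc, ← Real.exp_add]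
  congr 2
  ring

omit [GaugeGroup G] [MeasurableSpace G] [HaarData G] in
/-- The interpolant at `θ`, written out: `χ(u₀←y)·e^{(1−θ)h(u₀←y) + θh(u←y)}` — the Gibbs density with the convex
combination of the two exponents. [folklore] -/
theorem expTilt_fibreDensity_apply (s : Finset (PBond P j)) (χ h : Density P j G) (u₀ u : GaugeField P j G) (θ : ℝ)
    (y : s → G) :
    expTilt (fibreDensity s (fun U => χ U * Real.exp (h U)) u₀) (expGap s h u₀ u) θ y =
      χ (updateFinset u₀ s y) * Real.exp ((1 - θ) * h (updateFinset u₀ s y) + θ * h (updateFinset u s y)) := by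
  simp only [fibreDensity, expTilt_apply, expGap_apply]
  rw [mul_assoc, ← Real.exp_add]
  congr 2
  ring

/-- THE PATH LAW between the conditional laws at `u₀` (`θ = 0`) and at `u` (`θ = 1`): the normalised law, against the base
law of the fibre, of the interpolated Gibbs density. [folklore] -/
def pathLaw (s : Finset (PBond P j)) (χ h : Density P j G) (u₀ u : GaugeField P j G) (θ : ℝ) : Measure (s → G) :=
  tiltLaw (fibreBase s) (fibreDensity s (fun U => χ U * Real.exp (h U)) u₀) (expGap s h u₀ u) θ

/-- THE PATH VARIANCE of an insert `F` on the fibre (for `F = expGap s h u₀ u`: of the exponent gap) under the path law at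
`θ` — the quantity the (VAR) inputs bound. [folklore] -/
def pathVar (s : Finset (PBond P j)) (χ h : Density P j G) (u₀ u : GaugeField P j G) (F : (s → G) → E) (θ : ℝ) : ℝ :=
  tiltVar (fibreBase s) (fibreDensity s (fun U => χ U * Real.exp (h U)) u₀) (expGap s h u₀ u) F θ

/-- The path law written out as a normalised law of the interpolated Gibbs density. [folklore] -/
theorem pathLaw_eq_normLaw_interp (s : Finset (PBond P j)) (χ h : Density P j G) (u₀ u : GaugeField P j G) (θ : ℝ) :
    pathLaw s χ h u₀ u θ = normLaw (fibreBase s) fun y =>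
      χ (updateFinset u₀ s y) * Real.exp ((1 - θ) * h (updateFinset u₀ s y) + θ * h (updateFinset u s y)) := by
  rw [pathLaw, tiltLaw]
  congr 1
  exact funext fun y => expTilt_fibreDensity_apply s χ h u₀ u θ y

/-- (T2) THE REFERENCE ENDPOINT: `condLaw s old u₀` is the path law at `θ = 0` (any exponent). [folklore] -/
theorem condLaw_eq_tiltLaw_zero (s : Finset (PBond P j)) (old : Density P j G) (u₀ : GaugeField P j G)
    (g : (s → G) → ℝ) : condLaw s old u₀ = tiltLaw (fibreBase s) (fibreDensity s old u₀) g 0 := by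
  rw [condLaw_eq_normLaw, tiltLaw_zero]

/-- (T2) THE MOVING ENDPOINT: with an exterior-blind window, `condLaw s (χe^{h}) u` is the path law at `θ = 1`.
[folklore] -/
theorem condLaw_eq_tiltLaw_one (s : Finset (PBond P j)) (χ h : Density P j G) {u₀ u : GaugeField P j G}
    (hbl : ∀ y : s → G, χ (updateFinset u s y) = χ (updateFinset u₀ s y)) :
    condLaw s (fun U => χ U * Real.exp (h U)) u =
      tiltLaw (fibreBase s) (fibreDensity s (fun U => χ U * Real.exp (h U)) u₀) (expGap s h u₀ u) 1 := by
  rw [condLaw_eq_normLaw, tiltLaw, fibreDensity_eq_expTilt_one s χ h hbl]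

/-- The endpoints of `pathLaw`, by name. [folklore] -/
theorem condLaw_eq_pathLaw_zero (s : Finset (PBond P j)) (χ h : Density P j G) (u₀ u : GaugeField P j G) :
    condLaw s (fun U => χ U * Real.exp (h U)) u₀ = pathLaw s χ h u₀ u 0 :=
  condLaw_eq_tiltLaw_zero s _ u₀ _

/-- … [folklore] -/
theorem condLaw_eq_pathLaw_one (s : Finset (PBond P j)) (χ h : Density P j G) {u₀ u : GaugeField P j G}
    (hbl : ∀ y : s → G, χ (updateFinset u s y) = χ (updateFinset u₀ s y)) :
    condLaw s (fun U => χ U * Real.exp (h U)) u = pathLaw s χ h u₀ u 1 :=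
  condLaw_eq_tiltLaw_one s χ h hbl

/-- THE STANDING DATA ON THE FIBRE: a measurable Gibbs density `0 ≤ χe^{h} ≤ C` with the printed proviso at `u₀` and a
bounded exponent gap give `TiltData` for the base law of the fibre. [folklore] -/
theorem tiltData_fibre (s : Finset (PBond P j)) {χ h : Density P j G} (hχm : Measurable χ) (hhm : Measurable h)
    (hχ0 : ∀ U, 0 ≤ χ U) {C : ℝ} (hC : ∀ U, χ U * Real.exp (h U) ≤ C) {u₀ u : GaugeField P j G}
    (hne : fibreIntegral s (fun U => χ U * Real.exp (h U)) u₀ ≠ 0) {K : ℝ}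
    (hK : ∀ y : s → G, |h (updateFinset u₀ s y) - h (updateFinset u s y)| ≤ K) :
    TiltData (fibreBase s) (fibreDensity s (fun U => χ U * Real.exp (h U)) u₀) (expGap s h u₀ u) where
  measurable_q := measurable_fibreDensity s (hχm.mul (Real.measurable_exp.comp hhm)) u₀
  nonneg_q _ := mul_nonneg (hχ0 _) (Real.exp_nonneg _)
  bdd_q := ⟨C, fun _ => hC _⟩
  pos_q := integral_fibreDensity_pos s (hχm.mul (Real.measurable_exp.comp hhm))
    (fun U => mul_nonneg (hχ0 U) (Real.exp_nonneg _)) hC hne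
  measurable_g := (hhm.comp measurable_updateFinset).sub (hhm.comp measurable_updateFinset)
  bdd_g := ⟨K, hK⟩

/-- Every path law is a probability measure. [folklore] -/
theorem isProbabilityMeasure_pathLaw (s : Finset (PBond P j)) {χ h : Density P j G} (hχm : Measurable χ)
    (hhm : Measurable h) (hχ0 : ∀ U, 0 ≤ χ U) {C : ℝ} (hC : ∀ U, χ U * Real.exp (h U) ≤ C) {u₀ u : GaugeField P j G}
    (hne : fibreIntegral s (fun U => χ U * Real.exp (h U)) u₀ ≠ 0) {K : ℝ}
    (hK : ∀ y : s → G, |h (updateFinset u₀ s y) - h (updateFinset u s y)| ≤ K) (θ : ℝ) :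
    IsProbabilityMeasure (pathLaw s χ h u₀ u θ) :=
  isProbabilityMeasure_tiltLaw (tiltData_fibre s hχm hhm hχ0 hC hne hK) θ

/-- The path from the reference exterior to itself is constant: every path law is `condLaw s old u₀`. [folklore] -/
theorem pathLaw_self (s : Finset (PBond P j)) (χ h : Density P j G) (u₀ : GaugeField P j G) (θ : ℝ) :
    pathLaw s χ h u₀ u₀ θ = condLaw s (fun U => χ U * Real.exp (h U)) u₀ := by
  rw [pathLaw, tiltLaw, expGap_self, expTilt_const_zero, ← condLaw_eq_normLaw]

/-- … so the path variances at `u = u₀` are the variances under `condLaw s old u₀`. [folklore] -/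
theorem pathVar_self (s : Finset (PBond P j)) (χ h : Density P j G) (u₀ : GaugeField P j G) (F : (s → G) → E)
    (θ : ℝ) : pathVar s χ h u₀ u₀ F θ = ∫ y, ‖F y - ∫ t, F t ∂condLaw s (fun U => χ U * Real.exp (h U)) u₀‖ ^ 2
      ∂condLaw s (fun U => χ U * Real.exp (h U)) u₀ := by
  rw [← pathLaw_self s χ h u₀ θ]
  rfl

/-- **(T3) THE COVARIANCE RESPONSE OF THE CONDITIONAL MEAN IN THE EXTERIOR.**  For a measurable Gibbs density
`0 ≤ χe^{h} ≤ C` with the printed proviso at `u₀`, an exterior-blind window on the fibre, a bounded exponent gap, a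
bounded a.e.-strongly-measurable insert `F`, and PATH-VARIANCE BOUNDS (inputs, caveat (VAR)) `Var_θ(expGap) ≤ Vg`,
`Var_θ(F) ≤ VF` on `θ ∈ [0,1]`: `‖∫F ∂condLaw s old u − ∫F ∂condLaw s old u₀‖ ≤ √Vg·√VF`. [folklore] -/
theorem norm_condMean_sub_le_of_varianceBound [CompleteSpace E] (s : Finset (PBond P j)) {χ h : Density P j G}
    (hχm : Measurable χ) (hhm : Measurable h) (hχ0 : ∀ U, 0 ≤ χ U) {C : ℝ} (hC : ∀ U, χ U * Real.exp (h U) ≤ C)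
    {u₀ u : GaugeField P j G} (hne : fibreIntegral s (fun U => χ U * Real.exp (h U)) u₀ ≠ 0)
    (hbl : ∀ y : s → G, χ (updateFinset u s y) = χ (updateFinset u₀ s y)) {K : ℝ}
    (hK : ∀ y : s → G, |h (updateFinset u₀ s y) - h (updateFinset u s y)| ≤ K) {F : (s → G) → E}
    (hF : AEStronglyMeasurable F (fibreBase s)) {R : ℝ} (hR : ∀ y, ‖F y‖ ≤ R) {Vg VF : ℝ}
    (hVg : ∀ θ ∈ Set.Icc (0 : ℝ) 1, pathVar s χ h u₀ u (expGap s h u₀ u) θ ≤ Vg)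
    (hVF : ∀ θ ∈ Set.Icc (0 : ℝ) 1, pathVar s χ h u₀ u F θ ≤ VF) :
    ‖(∫ y, F y ∂condLaw s (fun U => χ U * Real.exp (h U)) u) -
        ∫ y, F y ∂condLaw s (fun U => χ U * Real.exp (h U)) u₀‖ ≤ Real.sqrt Vg * Real.sqrt VF := by
  rw [condLaw_eq_tiltLaw_one s χ h hbl,
    condLaw_eq_tiltLaw_zero s (fun U => χ U * Real.exp (h U)) u₀ (expGap s h u₀ u)]
  exact norm_tiltMean_one_sub_zero_le (tiltData_fibre s hχm hhm hχ0 hC hne hK) hF hR hVg hVF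

/-- **(T3′) THE OSCILLATION FORM ON THE FIBRE** (unconditional): an exponent gap oscillating by `≤ ε` about a constant
`κ` on the fibre and an insert with `‖F − c‖ ≤ M` give `‖∫F ∂condLaw s old u − ∫F ∂condLaw s old u₀‖ ≤ ε·(2M)` — the
data of `T4TiltModulus.norm_integral_condLaw_sub_le` with `fibreRatioClose_of_exp`, whose bound is `(e^{2ε} − 1)·M`.
[folklore] -/
theorem norm_condMean_sub_le_of_osc [CompleteSpace E] (s : Finset (PBond P j)) {χ h : Density P j G}
    (hχm : Measurable χ) (hhm : Measurable h) (hχ0 : ∀ U, 0 ≤ χ U) {C : ℝ} (hC : ∀ U, χ U * Real.exp (h U) ≤ C)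
    {u₀ u : GaugeField P j G} (hne : fibreIntegral s (fun U => χ U * Real.exp (h U)) u₀ ≠ 0)
    (hbl : ∀ y : s → G, χ (updateFinset u s y) = χ (updateFinset u₀ s y)) {κ ε : ℝ}
    (hε : ∀ y : s → G, |h (updateFinset u₀ s y) - h (updateFinset u s y) - κ| ≤ ε) (hε0 : 0 ≤ ε)
    {F : (s → G) → E} (hF : AEStronglyMeasurable F (fibreBase s)) {c : E} {M : ℝ} (hM : ∀ y, ‖F y - c‖ ≤ M) :
    ‖(∫ y, F y ∂condLaw s (fun U => χ U * Real.exp (h U)) u) -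
        ∫ y, F y ∂condLaw s (fun U => χ U * Real.exp (h U)) u₀‖ ≤ ε * (2 * M) := by
  have hK : ∀ y : s → G, |h (updateFinset u₀ s y) - h (updateFinset u s y)| ≤ ε + |κ| := fun y => by
    have := hε y
    calc |h (updateFinset u₀ s y) - h (updateFinset u s y)|
          = |(h (updateFinset u₀ s y) - h (updateFinset u s y) - κ) + κ| := by rw [sub_add_cancel]
      _ ≤ |h (updateFinset u₀ s y) - h (updateFinset u s y) - κ| + |κ| := abs_add_le _ _
      _ ≤ ε + |κ| := add_le_add this le_rfl
  have hM0 : 0 ≤ M := (norm_nonneg _).trans (hM fun _ => 1)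
  rw [condLaw_eq_tiltLaw_one s χ h hbl,
    condLaw_eq_tiltLaw_zero s (fun U => χ U * Real.exp (h U)) u₀ (expGap s h u₀ u)]
  exact norm_tiltMean_one_sub_zero_le_of_osc (tiltData_fibre s hχm hhm hχ0 hC hne hK) hF hε hε0 hM hM0

/-! ## §3  Discharge BY NAME of `MeanLipschitz` / `CondMeanSuppression` (the format of `T4TiltModulus` §3) -/

/-- THE RESPONSE DOMAIN of exteriors `u` relative to the reference `u₀`, for bond inserts `B` on `S`, a deviation
functional `dev` and two response moduli `σ`, `τ`: the window is exterior-blind on the fibre, the exponent gap is bounded,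
`0 ≤ dev u`, and along the path the variance of the gap is `≤ (σ·dev u)²` and that of each insert `≤ τ²`.  The variance
conditions are the (VAR) INPUTS — NOT PROVED for Bałaban's densities. [folklore] -/
def respDom {β : Type*} (s : Finset (PBond P j)) (χ h : Density P j G) (u₀ : GaugeField P j G)
    (B : (s → G) → β → E) (S : Finset β) (dev : GaugeField P j G → ℝ) (σ τ : ℝ) : Set (GaugeField P j G) :=
  {u | (∀ y : s → G, χ (updateFinset u s y) = χ (updateFinset u₀ s y)) ∧
    (∃ K : ℝ, ∀ y : s → G, |h (updateFinset u₀ s y) - h (updateFinset u s y)| ≤ K) ∧ 0 ≤ dev u ∧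
    (∀ θ ∈ Set.Icc (0 : ℝ) 1, pathVar s χ h u₀ u (expGap s h u₀ u) θ ≤ (σ * dev u) ^ 2) ∧
    ∀ b ∈ S, ∀ θ ∈ Set.Icc (0 : ℝ) 1, pathVar s χ h u₀ u (fun y => B y b) θ ≤ τ ^ 2}

/-- Non-vacuity: the reference exterior lies in its own response domain as soon as `0 ≤ dev u₀` and the variances of
the inserts under `condLaw s old u₀` are `≤ τ²` (the gap vanishes identically there). [folklore] -/
theorem self_mem_respDom {β : Type*} (s : Finset (PBond P j)) (χ h : Density P j G) (u₀ : GaugeField P j G)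
    (B : (s → G) → β → E) (S : Finset β) {dev : GaugeField P j G → ℝ} {σ τ : ℝ} (hdev : 0 ≤ dev u₀)
    (hτ : ∀ b ∈ S, ∫ y, ‖B y b - ∫ t, B t b ∂condLaw s (fun U => χ U * Real.exp (h U)) u₀‖ ^ 2
      ∂condLaw s (fun U => χ U * Real.exp (h U)) u₀ ≤ τ ^ 2) :
    u₀ ∈ respDom s χ h u₀ B S dev σ τ := by
  rw [respDom, Set.mem_setOf_eq]
  refine ⟨fun _ => rfl, ⟨0, fun y => by rw [sub_self, abs_zero]⟩, hdev, fun θ _ => ?_, fun b hb θ _ => ?_⟩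
  · rw [pathVar_self, expGap_self]
    simp only [sub_self, norm_zero, ne_eq, OfNat.ofNat_ne_zero, not_false_eq_true, zero_pow, integral_zero]
    exact sq_nonneg _
  · rw [pathVar_self]
    exact hτ b hb

/-- **(T4) `MeanLipschitz` FROM THE COVARIANCE RESPONSE.**  For a measurable Gibbs density `0 ≤ χe^{h} ≤ C` with the
printed proviso at `u₀` and bounded a.e.-strongly-measurable bond inserts `y ↦ B y b` (`b ∈ S`): the exterior-indexed
conditional mean field satisfies pv16's `T4FirstOrderSize.MeanLipschitz` on `respDom s χ h u₀ B S dev σ τ` with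
`lip := σ·τ` — no exponential of any oscillation (compare `T4TiltModulus.meanLipschitz_of_tilt`: `lip = 2e^{2ε₀}M`).
[folklore] -/
theorem meanLipschitz_of_varianceBound [CompleteSpace E] {β : Type*} (s : Finset (PBond P j)) {χ h : Density P j G}
    (hχm : Measurable χ) (hhm : Measurable h) (hχ0 : ∀ U, 0 ≤ χ U) {C : ℝ} (hC : ∀ U, χ U * Real.exp (h U) ≤ C)
    {u₀ : GaugeField P j G} (hne : fibreIntegral s (fun U => χ U * Real.exp (h U)) u₀ ≠ 0)
    {B : (s → G) → β → E} {S : Finset β} (hB : ∀ b ∈ S, AEStronglyMeasurable (fun y => B y b) (fibreBase s))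
    {R : ℝ} (hR : ∀ b ∈ S, ∀ y, ‖B y b‖ ≤ R) {dev : GaugeField P j G → ℝ} {σ τ : ℝ} (hσ : 0 ≤ σ) (hτ : 0 ≤ τ) :
    MeanLipschitz (respDom s χ h u₀ B S dev σ τ)
      (fun u b => ∫ y, B y b ∂condLaw s (fun U => χ U * Real.exp (h U)) u) S u₀ dev (σ * τ) := by
  intro u hu b hb
  obtain ⟨hbl, ⟨K, hK⟩, hdev, hVg, hVF⟩ := hu
  calc ‖(∫ y, B y b ∂condLaw s (fun U => χ U * Real.exp (h U)) u) -
          ∫ y, B y b ∂condLaw s (fun U => χ U * Real.exp (h U)) u₀‖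
        ≤ Real.sqrt ((σ * dev u) ^ 2) * Real.sqrt (τ ^ 2) :=
          norm_condMean_sub_le_of_varianceBound s hχm hhm hχ0 hC hne hbl hK (hB b hb) (hR b hb) hVg (hVF b hb)
    _ = σ * τ * dev u := by rw [Real.sqrt_sq (mul_nonneg hσ hdev), Real.sqrt_sq hτ]; ring

/-- (T4) … hence, with `MeanVanishes` at the reference exterior (row O3.E-i′ (α)/K, NOT touched here), pv16's
`CondMeanSuppression` on the response domain — by `condMeanSuppression_of_flat`. [folklore] -/
theorem condMeanSuppression_of_varianceBound [CompleteSpace E] {β : Type*} (s : Finset (PBond P j))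
    {χ h : Density P j G} (hχm : Measurable χ) (hhm : Measurable h) (hχ0 : ∀ U, 0 ≤ χ U) {C : ℝ}
    (hC : ∀ U, χ U * Real.exp (h U) ≤ C) {u₀ : GaugeField P j G}
    (hne : fibreIntegral s (fun U => χ U * Real.exp (h U)) u₀ ≠ 0) {B : (s → G) → β → E} {S : Finset β}
    (hB : ∀ b ∈ S, AEStronglyMeasurable (fun y => B y b) (fibreBase s)) {R : ℝ} (hR : ∀ b ∈ S, ∀ y, ‖B y b‖ ≤ R)
    {dev : GaugeField P j G → ℝ} {σ τ : ℝ} (hσ : 0 ≤ σ) (hτ : 0 ≤ τ)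
    (hflat : MeanVanishes S fun b => ∫ y, B y b ∂condLaw s (fun U => χ U * Real.exp (h U)) u₀) :
    CondMeanSuppression (respDom s χ h u₀ B S dev σ τ)
      (fun u b => ∫ y, B y b ∂condLaw s (fun U => χ U * Real.exp (h U)) u) S dev (σ * τ) :=
  condMeanSuppression_of_flat (hL := meanLipschitz_of_varianceBound s hχm hhm hχ0 hC hne hB hR hσ hτ) hflat

omit [GaugeGroup G] [MeasurableSpace G] [HaarData G] in
/-- THE OSCILLATION DOMAIN of exteriors: exterior-blind window and exponent gap within `ε u` of a free constant `κ u` on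
the fibre, `0 ≤ ε u` — the Gibbs-form content of `T4TiltModulus.tiltDom` (via `fibreRatioClose_of_exp`) WITHOUT the
ceiling `ε u ≤ ε₀`.  The size of `ε` for Bałaban's exponents is NOT this module's (caveat (LOG)). [folklore] -/
def oscDom (s : Finset (PBond P j)) (χ h : Density P j G) (u₀ : GaugeField P j G) (κ ε : GaugeField P j G → ℝ) :
    Set (GaugeField P j G) :=
  {u | (∀ y : s → G, χ (updateFinset u s y) = χ (updateFinset u₀ s y)) ∧
    (∀ y : s → G, |h (updateFinset u₀ s y) - h (updateFinset u s y) - κ u| ≤ ε u) ∧ 0 ≤ ε u}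

omit [GaugeGroup G] [MeasurableSpace G] [HaarData G] in
/-- Non-vacuity: the reference exterior lies in its own oscillation domain (`κ u₀ = 0 ≤ ε u₀`). [folklore] -/
theorem self_mem_oscDom (s : Finset (PBond P j)) (χ h : Density P j G) (u₀ : GaugeField P j G)
    {κ ε : GaugeField P j G → ℝ} (hκ : κ u₀ = 0) (hε : 0 ≤ ε u₀) : u₀ ∈ oscDom s χ h u₀ κ ε := by
  rw [oscDom, Set.mem_setOf_eq, hκ]
  exact ⟨fun _ => rfl, fun y => by rw [sub_self, sub_zero, abs_zero]; exact hε, hε⟩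

/-- **(T4′) `MeanLipschitz` FROM THE OSCILLATION FORM** (unconditional): same data as `T4TiltModulus.meanLipschitz_of_tilt`
in Gibbs form (inserts with `‖B y b − c b‖ ≤ M`), conclusion on `oscDom s χ h u₀ κ ε` with `dev := ε` and `lip := 2M` —
in place of `2e^{2ε₀}M` on the capped tilt domain. [folklore] -/
theorem meanLipschitz_of_osc [CompleteSpace E] {β : Type*} (s : Finset (PBond P j)) {χ h : Density P j G}
    (hχm : Measurable χ) (hhm : Measurable h) (hχ0 : ∀ U, 0 ≤ χ U) {C : ℝ} (hC : ∀ U, χ U * Real.exp (h U) ≤ C)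
    {u₀ : GaugeField P j G} (hne : fibreIntegral s (fun U => χ U * Real.exp (h U)) u₀ ≠ 0)
    {κ ε : GaugeField P j G → ℝ} {B : (s → G) → β → E} {S : Finset β}
    (hB : ∀ b ∈ S, AEStronglyMeasurable (fun y => B y b) (fibreBase s)) {c : β → E} {M : ℝ}
    (hM : ∀ b ∈ S, ∀ y, ‖B y b - c b‖ ≤ M) :
    MeanLipschitz (oscDom s χ h u₀ κ ε) (fun u b => ∫ y, B y b ∂condLaw s (fun U => χ U * Real.exp (h U)) u) S u₀ ε
      (2 * M) := by
  intro u hu b hb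
  obtain ⟨hbl, hεu, hε0⟩ := hu
  calc ‖(∫ y, B y b ∂condLaw s (fun U => χ U * Real.exp (h U)) u) -
          ∫ y, B y b ∂condLaw s (fun U => χ U * Real.exp (h U)) u₀‖ ≤ ε u * (2 * M) :=
        norm_condMean_sub_le_of_osc s hχm hhm hχ0 hC hne hbl hεu hε0 (hB b hb) (hM b hb)
    _ = 2 * M * ε u := mul_comm _ _

/-- (T4′) … hence `CondMeanSuppression` on the oscillation domain with `lip = 2M`, given `MeanVanishes` at `u₀`.
[folklore] -/
theorem condMeanSuppression_of_osc [CompleteSpace E] {β : Type*} (s : Finset (PBond P j)) {χ h : Density P j G}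
    (hχm : Measurable χ) (hhm : Measurable h) (hχ0 : ∀ U, 0 ≤ χ U) {C : ℝ} (hC : ∀ U, χ U * Real.exp (h U) ≤ C)
    {u₀ : GaugeField P j G} (hne : fibreIntegral s (fun U => χ U * Real.exp (h U)) u₀ ≠ 0)
    {κ ε : GaugeField P j G → ℝ} {B : (s → G) → β → E} {S : Finset β}
    (hB : ∀ b ∈ S, AEStronglyMeasurable (fun y => B y b) (fibreBase s)) {c : β → E} {M : ℝ}
    (hM : ∀ b ∈ S, ∀ y, ‖B y b - c b‖ ≤ M)
    (hflat : MeanVanishes S fun b => ∫ y, B y b ∂condLaw s (fun U => χ U * Real.exp (h U)) u₀) :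
    CondMeanSuppression (oscDom s χ h u₀ κ ε) (fun u b => ∫ y, B y b ∂condLaw s (fun U => χ U * Real.exp (h U)) u) S
      ε (2 * M) :=
  condMeanSuppression_of_flat (hL := meanLipschitz_of_osc s hχm hhm hχ0 hC hne hB hM) hflat

/-- **(T4″) THE PAIR-MEAN LIPSCHITZ BINDER FROM THE OSCILLATION FORM.**  Same data as
`T4TiltModulus.pairMeanField_lipschitz_of_tilt` in Gibbs form, for pv28-g4's pair mean field of commutator inserts
`pairMeanField (condLaw s old u) B` (values in `Fin 2 → Fin 2 → ℂ`): the hypothesis `hL` of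
`T4CoReadMoment.pairMean_norm_le_of_lipschitz` on `oscDom s χ h u₀ κ ε` with `dev := ε`, `lip := 2M` (vs. `2e^{2ε₀}M`).
[folklore] -/
theorem pairMeanField_lipschitz_of_osc {β : Type*} (s : Finset (PBond P j)) {χ h : Density P j G}
    (hχm : Measurable χ) (hhm : Measurable h) (hχ0 : ∀ U, 0 ≤ χ U) {C : ℝ} (hC : ∀ U, χ U * Real.exp (h U) ≤ C)
    {u₀ : GaugeField P j G} (hne : fibreIntegral s (fun U => χ U * Real.exp (h U)) u₀ ≠ 0)
    {κ ε : GaugeField P j G → ℝ} {B : (s → G) → β → Fin 2 → Fin 2 → ℂ} {S : Finset (β × β)}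
    (hB : ∀ p ∈ S, AEStronglyMeasurable (mcomm (fun y => B y p.1) (fun y => B y p.2)) (fibreBase s))
    {c : β × β → Fin 2 → Fin 2 → ℂ} {M : ℝ}
    (hM : ∀ p ∈ S, ∀ y, ‖mcomm (fun y => B y p.1) (fun y => B y p.2) y - c p‖ ≤ M) :
    ∀ u ∈ oscDom s χ h u₀ κ ε, ∀ p ∈ S,
      ‖pairMeanField (condLaw s (fun U => χ U * Real.exp (h U)) u) B p -
          pairMeanField (condLaw s (fun U => χ U * Real.exp (h U)) u₀) B p‖ ≤ 2 * M * ε u := by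
  intro u hu p hp
  obtain ⟨hbl, hεu, hε0⟩ := hu
  calc ‖pairMeanField (condLaw s (fun U => χ U * Real.exp (h U)) u) B p -
          pairMeanField (condLaw s (fun U => χ U * Real.exp (h U)) u₀) B p‖ ≤ ε u * (2 * M) :=
        norm_condMean_sub_le_of_osc s hχm hhm hχ0 hC hne hbl hεu hε0 (hB p hp) (hM p hp)
    _ = 2 * M * ε u := mul_comm _ _

/-- (T4″) … hence, with zero pair mean at the reference exterior (K9; NOT touched here), the pair-mean SUPPRESSION
`‖pairMeanField (condLaw s old u) B p‖ ≤ 2M·ε u` on the oscillation domain — by `pairMean_norm_le_of_lipschitz`.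
[folklore] -/
theorem pairMeanField_norm_le_of_osc {β : Type*} (s : Finset (PBond P j)) {χ h : Density P j G}
    (hχm : Measurable χ) (hhm : Measurable h) (hχ0 : ∀ U, 0 ≤ χ U) {C : ℝ} (hC : ∀ U, χ U * Real.exp (h U) ≤ C)
    {u₀ : GaugeField P j G} (hne : fibreIntegral s (fun U => χ U * Real.exp (h U)) u₀ ≠ 0)
    {κ ε : GaugeField P j G → ℝ} {B : (s → G) → β → Fin 2 → Fin 2 → ℂ} {S : Finset (β × β)}
    (hB : ∀ p ∈ S, AEStronglyMeasurable (mcomm (fun y => B y p.1) (fun y => B y p.2)) (fibreBase s))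
    {c : β × β → Fin 2 → Fin 2 → ℂ} {M : ℝ}
    (hM : ∀ p ∈ S, ∀ y, ‖mcomm (fun y => B y p.1) (fun y => B y p.2) y - c p‖ ≤ M)
    (hflat : ∀ p ∈ S, pairMeanField (condLaw s (fun U => χ U * Real.exp (h U)) u₀) B p = 0) :
    ∀ u ∈ oscDom s χ h u₀ κ ε, ∀ p ∈ S,
      ‖pairMeanField (condLaw s (fun U => χ U * Real.exp (h U)) u) B p‖ ≤ 2 * M * ε u :=
  pairMean_norm_le_of_lipschitz (m₂ := fun u => pairMeanField (condLaw s (fun U => χ U * Real.exp (h U)) u) B) hflat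
    (pairMeanField_lipschitz_of_osc s hχm hhm hχ0 hC hne hB hM)

end Fibre

end Literature.MathematicalPhysics.QuantumFieldTheory.Balaban1983to89.T4CovarianceResponse

end
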